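import Literature.NumberTheory.EllipticCurves.KodairaNeronUnramifiedAdditiveBoundProofs
import Literature.NumberTheory.EllipticCurves.InertiaInvariantsKodairaNeronAdditiveProofs
import Literature.NumberTheory.EllipticCurves.KodairaNeronUnramifiedInertiaProofs
import Summits.BirchSwinnertonDyer.Rank1Residual.X11b.LocalTrivialityBridge
import HarnessLib

/-!
# `E(K_v^nr)[p^∞]` is killed by `p` at an ADDITIVE place `v ∤ p` (`p` odd): the inertia-torsion
# hypothesis `hI` of `Additive/UnramifiedKummerDisjoint.lean`, from Kodaira–Néron over `K_v^nr`
# (cell `b2b-bsdres`, team n1011, seat p06 GEN 4; OWNERS row T-E3g-ADD, FILE B)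

HONEST FRAMING (cell `b2b-bsdres`, run/shared/lean/b2b/bsd-rank1-residual/, verbatim in every
file): the goal of the cell is to DELETE the COMBINATION-SHAPED residual classes of the
Birch–Swinnerton-Dyer formula for ALL analytic-rank `≤ 1` elliptic curves over `ℚ` — "full BSD
formula for every rank `≤ 1` curve in class `C`" assembled STRICTLY from published theorems — so
that the rank-`≤ 1` remainder becomes exactly the CONSTRUCTION-SHAPED classes, which are TYPED
(missing-input `Prop`s), NOT attempted. This is not "finishing BSD". Team n1011 (N10/N11: X4 ∧
`p = 3`): research routes on CONSTRUCTION-SHAPED classes; census output = EVIDENCE / conjecture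
items, never a Literature fact; RESIDUAL-MAP marks UNCHANGED; nothing is booked by this file.
THEOREMS ONLY: no definition, no named fact, nothing asserted.

## What (row T-E3g-ADD; FILE A = `Additive/UnramifiedKummerDisjoint.lean`)

FILE A proved `H¹_ur(K_v, E[p]) ⊓ 𝓚_v = ⊥` and the witness `∃ u ∈ H¹_ur(K_v, E[p]), u ∉ 𝓚_v` at a
finite `v ∤ p` under the THEOREM-SHAPED hypothesis

  `hI : ∀ Q ∈ E[p^∞](K̄), (∀ τ ∈ I_v, τ • Q = Q) → p • Q = 0`   ("`E(K_v^nr)[p^∞]` is killed by `p`").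

THIS FILE discharges `hI` at every place `v ∤ p` of ADDITIVE reduction, for `p` odd, from the tree's
Kodaira–Néron theory over `K_v^nr` — Silverman *AEC* Thm. VII.6.1 ("in all other cases … order at
most 4"), exported with its bound in
`Literature/…/KodairaNeronUnramifiedAdditiveBoundProofs.lean`
(`WeierstrassCurve.exists_nsmul_reducesToNonsingular_le_four_of_hasAdditiveReduction`: an exponent
`c ∈ {1,…,4}` with `c • P ∈ E₀` for every `I_𝔐`-fixed `P ∈ X(K̄_v)`, `X` the minimal model at `v`)
— along the transport of `InertiaInvariantsKodairaNeronAdditiveProofs` (Serre–Tate's argument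
"`V_ℓ(E(K^nr)) ≃ V_ℓ(E₀(K^nr)) ≃ V_ℓ(k̄⁺) = 0`" run on torsion POINTS instead of `V_ℓ`):

1. `Q ∈ E[p^∞](K̄)` fixed by `I_v = absInertia K_v` (acting through `Γ_{K_v} → Γ_K`) maps, along
   `pointsMap` and the equivariant change of model `Φ` (`exists_addEquiv_localPoints_of_smul_eq`),
   to a point `P ∈ X(K̄_v)` fixed by `I_𝔐` (`inertia_eq_absInertia`);
2. `c • P ∈ E₀` (Kodaira–Néron exponent, `c ≤ 4`); `E₀ → k̄⁺` (the reduction of the minimal model is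
   a cusp, `exists_addMonoidHom_residueField_of_cusp`) has kernel `E₁`, which has no `p`-torsion
   (`ReducesToZero.eq_zero_of_zsmul_eq_zero`, *AEC* VII.3.1), and `k̄⁺` has none either (`v ∤ p`);
   so the `p`-power-torsion point `c • P` of `E₀` is `0` (descending induction on the exponent);
3. hence `c • Q = 0` with `0 < c ≤ 4`; as `Q` is `p`-power torsion and `p` is odd,
   `gcd(c, p^m) ∣ p`, so `p • Q = 0` (`c = 3 = p` being the only case with `Q ≠ 0` possible:
   Kodaira IV / IV*).

Main results: `nsmul_eq_zero_of_absInertia_fixed_of_exponent` (steps 1–2 from an exponent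
statement), `smul_eq_zero_of_nsmul_eq_zero_of_le_four` (step 3),
`smul_eq_zero_of_absInertia_fixed_of_hasAdditiveReductionAt` (the discharge) and its
`restrictField` form `inertia_torsion_of_hasAdditiveReductionAt` = FILE A's `hI` verbatim.

References: J. H. Silverman, *AEC* 2nd ed. (2009) Thm. VII.6.1, Prop. VII.2.1, VII.3.1,
VII.5.1(c) [SilvermanAEC2009]; *ATAEC* (1994) Cor. IV.9.2(d), Table 4.1, proof of Thm. IV.10.2(a)
[SilvermanATAEC1994]; J.-P. Serre, J. Tate, Ann. of Math. 88 (1968) §1 Lemma 2 [SerreTate1968];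
R. Greenberg, LNM 1716 (1999) p. 74 ("`E₀(F_v)` is a pro-`l` group") [GreenbergLNM1716].
-/

set_option autoImplicit false

noncomputable section

open scoped Classical NNReal

open NumberField IsDedekindDomain Field IsDedekindDomain.HeightOneSpectrum
open Literature.NumberTheory.EllipticCurves Literature.NumberTheory.GaloisRepresentations
  Literature.NumberTheory.GaloisRepresentations.IsNonarchimedeanLocalField
open Summit.BirchSwinnertonDyer.Rank1Residual.X11b

namespace Summit.BirchSwinnertonDyer.Rank1Residual.Additive

universe u

variable {K : Type u} [Field K] [NumberField K] (W : WeierstrassCurve K) [W.IsElliptic] (p : ℕ)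
  [hp : Fact p.Prime] (v : HeightOneSpectrum (𝓞 K))

/-! ### §1 An elementary step: `p`-power torsion in `E₀` with trivial reduction to `k̄⁺` is `0` -/

omit hp in
/-- **No `p`-power torsion in the kernel of `E₀ → k̄⁺`** (for `|p|_w = 1`): if `r : E₀ → A` is a
homomorphism into a group without `p`-torsion whose kernel consists of the points reducing to `O`
(`E₁`, which has no prime-to-residue-characteristic torsion, *AEC* VII.3.1), then a point
`y ∈ E₀` with `p ^ m • y = 0` and `r y = 0` is `O`. (Descending induction: `p^{m-1} • y ∈ E₁` is
killed by `p`.) [cite: SilvermanAEC2009, VII.3 Prop. 3.1(a) and VII.2 Prop. 2.1 (PDF pp. 167–171)] -/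
theorem eq_zero_of_pow_nsmul_eq_zero_of_reducesToZero {L : Type u} [Field L]
    {w : Valuation L ℝ≥0} (W₀ : WeierstrassCurve w.integer) (hv0 : w.Integers w.integer)
    (hpw : w (p : ℤ) = 1) {A : Type*} [AddCommGroup A]
    (r : W₀.nonsingularReductionSubgroup hv0 →+ A)
    (hr : ∀ P : W₀.nonsingularReductionSubgroup hv0,
      r P = 0 ↔ W₀.ReducesToZero (P : (W₀.baseChange L).toAffine.Point))
    (m : ℕ) (y : W₀.nonsingularReductionSubgroup hv0) (hry : r y = 0) (hpy : p ^ m • y = 0) :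
    y = 0 := by
  induction m generalizing y with
  | zero => simpa using hpy
  | succ m ih =>
    -- `z = p^m • y` is killed by `p` and reduces to `O`, hence `z = 0`
    have hz : p ^ m • y = 0 := by
      set z := p ^ m • y with hz
      have hrz : r z = 0 := by rw [hz, map_nsmul, hry, smul_zero]
      have hpz : p • z = 0 := by rw [hz, ← mul_smul, ← pow_succ', hpy]
      have h0 : W₀.ReducesToZero (z : (W₀.baseChange L).toAffine.Point) := (hr z).mp hrz
      have hpz' : (p : ℤ) • (z : (W₀.baseChange L).toAffine.Point) = 0 := by
        rw [natCast_zsmul, ← AddSubgroupClass.coe_nsmul, hpz, ZeroMemClass.coe_zero]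
      exact Subtype.ext (h0.eq_zero_of_zsmul_eq_zero W₀ hpw hpz')
    exact ih y hry hz

/-! ### §2 From a Kodaira–Néron exponent on the minimal model to `c • Q = 0` -/

omit [W.IsElliptic] hp in
/-- **`c • Q = 0` for every `I_v`-fixed `Q ∈ E[p^∞](K̄)` at an additive `v ∤ p`, granted an
exponent `c` with `c • P ∈ E₀` for the `I_𝔐`-fixed points of the minimal model over `K̄_v`.**
Steps 1–2 of the module docstring: transport `Q ↦ P = Φ(pointsMap Q) ∈ X(K̄_v)` (equivariant,
`I_𝔐 = absInertia K_v`), `c • P ∈ E₀`, reduction `E₀ → k̄⁺` of the cuspidal minimal model with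
kernel `E₁` free of `p`-torsion, `k̄⁺` free of `p`-torsion (`v ∤ p`), so `c • P = 0` and `c • Q = 0`
by injectivity of the transport. (Serre–Tate's argument of *ATAEC* IV.10.2(a), additive case, on
torsion points.) [cite: SilvermanATAEC1994, Thm. IV.10.2(a), additive case, and its proof (PDF pp. 358–359)]
[cite: SilvermanAEC2009, VII.2 Prop. 2.1, VII.3 Prop. 3.1(a), VII.5 Prop. 5.1(c)] -/
theorem nsmul_eq_zero_of_absInertia_fixed_of_exponent
    (hpv : ((p : ℕ) : 𝓞 K) ∉ v.asIdeal) (hadd : W.HasAdditiveReductionAt v)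
    {w : Valuation (AlgebraicClosure (v.adicCompletion K)) ℝ≥0}
    (hw : ∀ x, (w x : ℝ) =
      spectralNorm (v.adicCompletion K) (AlgebraicClosure (v.adicCompletion K)) x)
    {𝔐 : Ideal v.localAbsIntegers} (h𝔐 : 𝔐 ∈ v.localPrimesAbove) {c : ℕ}
    (hcE₀ : ∀ P : ((W.localMinimalModel v).baseChange
        (AlgebraicClosure (v.adicCompletion K))).toAffine.Point,
      (∀ σ ∈ 𝔐.inertia (absoluteGaloisGroup (v.adicCompletion K)),
        WeierstrassCurve.Affine.Point.map ((absoluteGaloisGroup.toAlgEquiv _ σ :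
            AlgebraicClosure (v.adicCompletion K) ≃ₐ[v.adicCompletion K]
              AlgebraicClosure (v.adicCompletion K)) :
            AlgebraicClosure (v.adicCompletion K) →ₐ[v.adicCompletion K]
              AlgebraicClosure (v.adicCompletion K)) P = P) →
      ReducesToNonsingular w (IsLocalRing.residue w.integer) (c • P))
    (Q : W.geomPrimaryTorsion p)
    (hQ : ∀ τ ∈ absInertia (v.adicCompletion K),
      absGaloisRestrict K (v.adicCompletion K) τ • Q = Q) :
    c • Q = 0 := by
  have hv0 : w.Integers w.integer := Valuation.integer.integers w
  -- a `w`-integral model `W₀` of the minimal model over `K̄_v`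
  have hint : ((W.localMinimalModel v).baseChange (AlgebraicClosure (v.adicCompletion K))).IsIntegral
      w.integer := by
    have := WeierstrassCurve.isIntegral_spectralValuation_baseChange hw
      ((W.localMinimalModel v).integralModel (v.adicCompletionIntegers K))
    rwa [show ((W.localMinimalModel v).integralModel (v.adicCompletionIntegers K)).map
        (algebraMap (v.adicCompletionIntegers K) (v.adicCompletion K)) = W.localMinimalModel v from
      WeierstrassCurve.baseChange_integralModel_eq (v.adicCompletionIntegers K)
        (W.localMinimalModel v)] at this
  obtain ⟨W₀, hW₀⟩ := hint.integral
  -- the reduction of `W₀` is a cusp: `r : E₀ → k̄⁺` with kernel `E₁`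
  have hcoef : ∀ {a : v.adicCompletionIntegers K} (b : w.integer),
      algebraMap w.integer (AlgebraicClosure (v.adicCompletion K)) b =
        algebraMap (v.adicCompletion K) (AlgebraicClosure (v.adicCompletion K))
          (algebraMap (v.adicCompletionIntegers K) (v.adicCompletion K) a) →
      IsDedekindDomain.HeightOneSpectrum.valuation (v.adicCompletion K)
          (IsDiscreteValuationRing.maximalIdeal (v.adicCompletionIntegers K))
          (algebraMap (v.adicCompletionIntegers K) (v.adicCompletion K) a) < 1 →
      IsLocalRing.residue w.integer b = 0 := by
    intro a b hab hlt
    have hmem : a ∈ IsLocalRing.maximalIdeal (v.adicCompletionIntegers K) :=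
      (IsDedekindDomain.HeightOneSpectrum.valuation_lt_one_iff_mem _ a).mp hlt
    rw [← v_algebraMap_lt_one_iff hv0, hab]
    exact WeierstrassCurve.spectralValuation_algebraMap_lt_one_of_mem_maximalIdeal hw h𝔐 hmem
  have hΔ : IsLocalRing.residue w.integer W₀.Δ = 0 := by
    refine hcoef (a := ((W.localMinimalModel v).integralModel (v.adicCompletionIntegers K)).Δ)
      W₀.Δ ?_ ?_
    · rw [WeierstrassCurve.integralModel_Δ_eq, ← WeierstrassCurve.map_Δ, ← WeierstrassCurve.map_Δ]
      change (W₀.baseChange (AlgebraicClosure (v.adicCompletion K))).Δ =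
        ((W.localMinimalModel v).baseChange (AlgebraicClosure (v.adicCompletion K))).Δ
      rw [hW₀]
    · rw [WeierstrassCurve.integralModel_Δ_eq]; exact hadd.badReduction
  have hc₄ : IsLocalRing.residue w.integer W₀.c₄ = 0 := by
    refine hcoef (a := ((W.localMinimalModel v).integralModel (v.adicCompletionIntegers K)).c₄)
      W₀.c₄ ?_ ?_
    · rw [WeierstrassCurve.integralModel_c₄_eq, ← WeierstrassCurve.map_c₄, ← WeierstrassCurve.map_c₄]
      change (W₀.baseChange (AlgebraicClosure (v.adicCompletion K))).c₄ =
        ((W.localMinimalModel v).baseChange (AlgebraicClosure (v.adicCompletion K))).c₄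
      rw [hW₀]
    · rw [WeierstrassCurve.integralModel_c₄_eq]; exact hadd.additiveReduction
  obtain ⟨rc, hrc⟩ := W₀.exists_addMonoidHom_residueField_of_cusp hv0 hΔ hc₄
  -- the equivariant transport to the minimal model and the point `P`
  obtain ⟨C, hC⟩ := W.exists_variableChange_smul_eq_localMinimalModel v
  obtain ⟨Φ, hΦ⟩ := W.exists_addEquiv_localPoints_of_smul_eq v hC
  have hIeq : 𝔐.inertia (absoluteGaloisGroup (v.adicCompletion K)) =
      absInertia (v.adicCompletion K) := v.inertia_eq_absInertia hw h𝔐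
  set R : localPoints W (v.adicCompletion K) :=
    pointsMap W (v.adicCompletion K) (Q : W.geomPoints) with hR
  have hRfix : ∀ σ ∈ 𝔐.inertia (absoluteGaloisGroup (v.adicCompletion K)),
      WeierstrassCurve.Affine.Point.map ((absoluteGaloisGroup.toAlgEquiv _ σ :
          AlgebraicClosure (v.adicCompletion K) ≃ₐ[v.adicCompletion K]
            AlgebraicClosure (v.adicCompletion K)) :
          AlgebraicClosure (v.adicCompletion K) →ₐ[v.adicCompletion K]
            AlgebraicClosure (v.adicCompletion K)) (Φ R) = Φ R := by
    intro σ hσ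
    have hσ' : σ ∈ absInertia (v.adicCompletion K) := hIeq ▸ hσ
    have hQσ : resGal (K := K) (v.adicCompletion K) σ • (Q : W.geomPoints) = Q := by
      rw [WeierstrassCurve.resGal_eq_absGaloisRestrict, ← primaryComponent.coe_smul, hQ σ hσ']
    rw [← hΦ σ R, hR, ← pointsMap_smul, hQσ]
  -- `c • P ∈ E₀(W₀)`
  have hE₀ : W₀.HasNonsingularReduction
      (WeierstrassCurve.Affine.Point.congrEquiv hW₀ (c • Φ R)) :=
    (reducesToNonsingular_iff_hasNonsingularReduction W₀ _).mp
      ((reducesToNonsingular_congrEquiv_iff _ hW₀ _).mpr (hcE₀ _ hRfix))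
  set y : W₀.nonsingularReductionSubgroup hv0 :=
    ⟨WeierstrassCurve.Affine.Point.congrEquiv hW₀ (c • Φ R), hE₀⟩ with hy
  -- `y` is `p`-power torsion
  obtain ⟨m, hm⟩ : ∃ m : ℕ, p ^ m • (Q : W.geomPoints) = 0 :=
    (AddCommGroup.mem_primaryComponent).mp Q.2
  have hpmR : p ^ m • R = 0 := by rw [hR, ← map_nsmul, hm, map_zero]
  have hpy : p ^ m • y = 0 := by
    apply Subtype.ext
    rw [AddSubgroupClass.coe_nsmul, ZeroMemClass.coe_zero, hy, ← map_nsmul, smul_comm, ← map_nsmul,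
      hpmR, map_zero, smul_zero, map_zero]
  -- `r y` is killed by `p^m` in `k̄`, where `p ≠ 0`
  have hpw : w ((p : ℤ) : AlgebraicClosure (v.adicCompletion K)) = 1 :=
    spectralValuation_intCast_eq_one hw (n := (p : ℤ)) (by simpa using hpv)
  have hpk : ((p : ℕ) : AlgebraicClosure (IsLocalRing.ResidueField w.integer)) ≠ 0 := by
    have hpw' : w (algebraMap w.integer (AlgebraicClosure (v.adicCompletion K)) (p : w.integer)) = 1 := by
      rw [map_natCast]; exact_mod_cast hpw
    have h1 : IsLocalRing.residue w.integer (p : w.integer) ≠ 0 :=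
      (v_algebraMap_eq_one_iff hv0 _).mp hpw'
    have := (_root_.map_ne_zero (algebraMap (IsLocalRing.ResidueField w.integer)
      (AlgebraicClosure (IsLocalRing.ResidueField w.integer)))).mpr h1
    simpa using this
  have hA : ∀ a : AlgebraicClosure (IsLocalRing.ResidueField w.integer), p • a = 0 → a = 0 := by
    intro a ha
    rw [nsmul_eq_mul, mul_eq_zero] at ha
    exact ha.resolve_left hpk
  have aux : ∀ (n : ℕ) (a : AlgebraicClosure (IsLocalRing.ResidueField w.integer)),
      p ^ n • a = 0 → a = 0 := by
    intro n
    induction n with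
    | zero => intro a h; simpa using h
    | succ n ih =>
      intro a h
      rw [pow_succ, mul_smul] at h
      exact hA a (ih _ h)
  have hry : rc y = 0 := aux m _ (by rw [← map_nsmul, hpy, map_zero])
  -- hence `y = 0`, `c • Φ R = 0`, `c • Q = 0`
  have hy0 : y = 0 := eq_zero_of_pow_nsmul_eq_zero_of_reducesToZero p W₀ hv0 hpw rc hrc m y hry hpy
  have hcR : c • R = 0 := by
    have h1 : WeierstrassCurve.Affine.Point.congrEquiv hW₀ (c • Φ R) = 0 := congrArg Subtype.val hy0
    have h2 : c • Φ R = 0 := by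
      rw [← (WeierstrassCurve.Affine.Point.congrEquiv hW₀).map_zero] at h1
      exact (WeierstrassCurve.Affine.Point.congrEquiv hW₀).injective h1
    rw [← map_nsmul] at h2
    rw [← Φ.map_eq_zero_iff, h2]
  apply Subtype.ext
  apply pointsMapOfEmb_injective W (closureEmb (K := K) (v.adicCompletion K))
  change pointsMap W (v.adicCompletion K) ((c • Q : W.geomPrimaryTorsion p) : W.geomPoints) =
    pointsMap W (v.adicCompletion K) ((0 : W.geomPrimaryTorsion p) : W.geomPoints)
  rw [AddSubgroupClass.coe_nsmul, map_nsmul, ← hR, hcR, ZeroMemClass.coe_zero, map_zero]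

/-! ### §3 `c • Q = 0` with `0 < c ≤ 4`, `Q` `p`-power torsion, `p` odd `⟹ p • Q = 0` -/

/-- **Step 3.** If `c • Q = 0` with `0 < c ≤ 4`, `p ^ m • Q = 0` and `p` is an odd prime, then
`p • Q = 0`: the order of `Q` divides `gcd(c, p^m)`, a power of `p` that is `≤ 4 < p²`, hence
divides `p`. [folklore] -/
theorem smul_eq_zero_of_nsmul_eq_zero_of_le_four {A : Type*} [AddCommGroup A] (hp2 : p ≠ 2)
    {c : ℕ} (hc0 : 0 < c) (hc4 : c ≤ 4) {Q : A} (hcQ : c • Q = 0) {m : ℕ} (hmQ : p ^ m • Q = 0) :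
    p • Q = 0 := by
  have hprime := hp.out
  have h3 : 3 ≤ p := by
    rcases Nat.lt_or_ge p 3 with h | h
    · interval_cases p <;> simp_all [Nat.not_prime_zero, Nat.not_prime_one]
    · exact h
  -- the order of `Q` divides `gcd(c, p^m)`
  have hoc : addOrderOf Q ∣ c := addOrderOf_dvd_of_nsmul_eq_zero hcQ
  have hom : addOrderOf Q ∣ p ^ m := addOrderOf_dvd_of_nsmul_eq_zero hmQ
  obtain ⟨j, hj, hoj⟩ := (Nat.dvd_prime_pow hprime).mp hom
  -- `p ^ j ∣ c ≤ 4 < p ^ 2` forces `j ≤ 1`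
  have hj1 : j ≤ 1 := by
    by_contra hj2
    have hle : p ^ 2 ≤ p ^ j := Nat.pow_le_pow_right hprime.pos (by omega)
    have hdvd : p ^ j ∣ c := hoj ▸ hoc
    have hcle : p ^ j ≤ c := Nat.le_of_dvd hc0 hdvd
    nlinarith
  have hdvdp : addOrderOf Q ∣ p := by
    rw [hoj]
    exact (Nat.pow_dvd_pow p hj1).trans (by rw [pow_one])
  exact addOrderOf_dvd_iff_nsmul_eq_zero.mp hdvdp

/-! ### §4 The discharge of `hI` at an additive place `v ∤ p`, `p` odd -/

/-- **`E(K_v^nr)[p^∞]` is killed by `p` at every ADDITIVE place `v ∤ p`, `p` odd**: for an elliptic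
curve `E` over a number field `K` with additive reduction at `v`, `v ∤ p`, `p ≠ 2`, every point
`Q ∈ E[p^∞](K̄)` fixed by the inertia group `absInertia K_v` (through `Γ_{K_v} → Γ_K`) satisfies
`p • Q = 0`.  Kodaira–Néron (*AEC* Thm. VII.6.1: `#E(K_v^nr)/E₀(K_v^nr) ≤ 4`, tree
`exists_nsmul_reducesToNonsingular_le_four_of_hasAdditiveReduction`) + §2 + §3.  (At an additive
`v ∤ p` with `p ∣ c_v` — Kodaira IV / IV*, `p = 3` — `E(K_v)[3] ≅ ℤ/3` shows the statement is
sharp; at `p ≥ 5` it says `E(K_v^nr)[p^∞] = 0`.)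
[cite: SilvermanAEC2009, Thm. VII.6.1 (PDF p. 177)]
[cite: SilvermanATAEC1994, Thm. IV.10.2(a), additive case, and its proof (PDF pp. 358–359)] -/
theorem smul_eq_zero_of_absInertia_fixed_of_hasAdditiveReductionAt
    (hpv : ((p : ℕ) : 𝓞 K) ∉ v.asIdeal) (hp2 : p ≠ 2) (hadd : W.HasAdditiveReductionAt v)
    (Q : W.geomPrimaryTorsion p)
    (hQ : ∀ τ ∈ absInertia (v.adicCompletion K),
      absGaloisRestrict K (v.adicCompletion K) τ • Q = Q) :
    p • Q = 0 := by
  obtain ⟨w, hw⟩ := v.exists_spectralValuation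
  obtain ⟨𝔐, h𝔐⟩ := v.localPrimesAbove_nonempty
  haveI : (W.localMinimalModel v).IsElliptic := W.isElliptic_localMinimalModel v
  haveI : (W.localMinimalModel v).HasAdditiveReduction (v.adicCompletionIntegers K) := hadd
  obtain ⟨c, hc0, hc4, hcE₀⟩ :=
    (W.localMinimalModel v).exists_nsmul_reducesToNonsingular_le_four_of_hasAdditiveReduction w hw h𝔐
  obtain ⟨m, hm⟩ : ∃ m : ℕ, p ^ m • Q = 0 := by
    obtain ⟨m, hm⟩ := (AddCommGroup.mem_primaryComponent).mp Q.2
    exact ⟨m, Subtype.ext (by rw [AddSubgroupClass.coe_nsmul, hm, ZeroMemClass.coe_zero])⟩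
  exact smul_eq_zero_of_nsmul_eq_zero_of_le_four p hp2 hc0 hc4
    (nsmul_eq_zero_of_absInertia_fixed_of_exponent W p v hpv hadd hw h𝔐 hcE₀ Q hQ) hm

/-- **FILE A's hypothesis `hI`, verbatim, at an additive place `v ∤ p` (`p` odd)**: every point of
`E[p^∞](K̄)|_{Γ_{K_v}}` (`GaloisRep.restrictField K_v (LocBridge.primaryGaloisModule W p)`) fixed by
`absInertia K_v` is killed by `p`. [cite: SilvermanAEC2009, Thm. VII.6.1 (PDF p. 177)] -/
theorem inertia_torsion_of_hasAdditiveReductionAt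
    (hpv : ((p : ℕ) : 𝓞 K) ∉ v.asIdeal) (hp2 : p ≠ 2) (hadd : W.HasAdditiveReductionAt v) :
    ∀ Q : W.geomPrimaryTorsion p,
      (∀ τ ∈ absInertia (v.adicCompletion K),
        GaloisRep.restrictField (v.adicCompletion K) (LocBridge.primaryGaloisModule W p) τ Q = Q) →
      p • Q = 0 :=
  fun Q hQ ↦ smul_eq_zero_of_absInertia_fixed_of_hasAdditiveReductionAt W p v hpv hp2 hadd Q
    (fun τ hτ ↦ by
      have h := hQ τ hτ
      rwa [GaloisRep.restrictField_apply] at h)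

end Summit.BirchSwinnertonDyer.Rank1Residual.Additive

end
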